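import Summits.BirchSwinnertonDyer.BirchSwinnertonDyer.Theorems.ByReductionTypeAtTwoAdditivePotGoodPrintFamily37a1Model
import Summits.BirchSwinnertonDyer.Rank1Residual.P2.TwistInvarianceAtTwo
import Summits.BirchSwinnertonDyer.Rank1Residual.X11b.KrausMinimalityGeneralTwo
import Summits.BirchSwinnertonDyer.Rank1Residual.X11b.CertificateCheckBridge
import Literature.NumberTheory.EllipticCurves.AdachiNomotoShii2026.TwoAdicValuationsTwistedLValues
import Literature.NumberTheory.EllipticCurves.Rank1Residual.PrintShape
import Literature.NumberTheory.EllipticCurves.Pal2012.QuadraticTwistPeriodProofs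
import Literature.NumberTheory.Sieve.PolymathLcmSumsEuler
import HarnessLib

/-!
# K4 crux `AdditiveRankZeroAtTwo` (19098), child C3″ `AdditivePotGoodLowerHalfAtTwo` (22617): the LOWER half of BSD₂
# BY PRINT on an INFINITE `E[2]`-IRREDUCIBLE family inside the additive, potentially good, non-CM, analytic-rank-0 block
# — the Adachi–Nomoto–Shii twists `37a1^{(−m)}`, `m = q₁⋯q_r`, `q_i ≡ 1 (mod 4)`, `q_i ≠ 37`, `a_{q_i}(37a1)` odd

Cell `bsd-2adic`, seat `bsd-2adic-k4-w2` GEN 5 (prover, explicit unit, no kit); `--supports stmt-BirchSwinnertonDyer-22617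
--as helper`. HONEST FRAMING (D-0036/D-0054): a conditional theorem; inputs BY NAME = Adachi–Nomoto–Shii 2026 Thm. 4.3
(`AdachiNomotoShii2026.thm43_rectangular_n1`, typed as printed by the b2b-p2 literature seat), modularity
(`hasEntireLFunction_rat`), Gross–Zagier–Kolyvagin (`rank_eq_analyticRank_of_analyticRank_le_one`), plus the DISPLAYED
base data of the one curve `37a1` in the fact's own currency — all PRINTED in the source (§1 Example and §5.2: "the
period lattice of `f₂` is rectangular, `v₂(L(f₂, χ₄, 1)/Ω⁻_{f₂}) = 0` … `y² + y = x³ − x` with Cremona label 37a1"; "the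
condition for the equality … holds if all primes `q_i` dividing `m` satisfy `q_i ≠ 37`, `q_i ≡ 1 mod 4` and `a_{q_i}` is
odd. For example 41, 53, 73, 101, 149, 157, … in fact, there are infinitely many such prime numbers"): an optimal
parametrisation datum with Manin constant `1`, `L(37a1,1) = x₁·Ω⁺` (any `x₁`; `= 0`), a global minimal model `W4` of
`37a1^{(−1)}` with `IsAlgPart 37a1 W4 (−1) x₄`, `val₂ x₄ = 1`, and `N(37a1) = 37`. NO reading, NO instrument; closes
nothing at the `∀`-level (C3″ stays research-open off the print families); nothing booked; BSD is not proved by any of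
this. Companion of `…PrintFamily56b1.lean` (Cai–Li–Zhai: the `E[2]`-REDUCIBLE family, both halves) and of the TOOLS file
`…PrintFamily37a1Model.lean` (global minimal model `V_D`, habitat, Pal's `ũ = 1/2`).

THE ARGUMENT (kernel, `printFamily37a1_lower`). `D = −m ≡ 3 (mod 4)`, `M = 4m`, `n = 1`, `37a1` rectangular
(`Δ = 37 > 0`): Thm. 4.3 (ii) with `v_m = 0` (all `q_i ∈ S₀⁺`) and its printed equality clause give the twisted
algebraic part `x` (`L(W,1) = x·Ω⁻(37a1)/√(4m)`, Thm. 2.1) with `val₂ x = w_m r + min{δ₀ + 1, val₂ x₄ + δ₂} = min{2, 1} = 1`,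
so `L(W,1) ≠ 0` (`r_an(W) = 0` under modularity) and `ord₂ x = 1`. Pal 2012 Thm. 3.2 (tree, PROVED) with the KERNEL
facts `ũ = 1/2` and `c_∞(W) = 2` gives `Ω(W)·√m = |Ω⁻(37a1)|`; hence `L(W,1)/Ω(W) = x/2` is a `2`-adic unit. With
`Reg(W) = 1` (rank `0`, GZK) and `#W(ℚ)_tors` ODD (`E[2]` irreducible, Mazur; tree `padicValNat_torsionOrder_eq_zero_of_irreducible`):
`#Ш_an(W) = x·#tors²/(2·Tam(W))`, `ord₂ #Ш_an(W) = −ord₂ Tam(W) ≤ 0 ≤ ord₂ #Ш(W)` — `MissingLowerBoundAt W 2`, for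
every global minimal `W ≅ 37a1^{(−m)}`; and `W` is ADDITIVE at `2`, POTENTIALLY GOOD (`ord₂ j = 12`), NON-CM, `E[2]`
IRREDUCIBLE (tools file). (BSD₂ predicts `Tam(W)` odd and `Ш(W)[2] = 0` here; the UPPER half is not claimed — ANS is an
analytic-side theorem.)

References: [AdachiNomotoShii2026] T. Adachi, K. Nomoto, R. Shii, Acta Arith. (2026), doi:10.4064/aa240320-5-10 =
arXiv:2403.11474: Thm. 2.1, Thm. 4.3, §1 Example, §5.2; [Pal2012] Thm. 3.2, Prop. 2.5; [Miller2011LMS] Def. 1.1;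
[SilvermanAEC2009] VII.5, VIII.8; [Mazur1978] Prop. 6.3 (1).
-/

set_option autoImplicit false
set_option linter.dupNamespace false

noncomputable section

open scoped Classical

open IsDedekindDomain NumberField Rat.HeightOneSpectrum WeierstrassCurve Literature.NumberTheory.EllipticCurves
  Literature.NumberTheory.DiophantineGeometry
  Literature.NumberTheory.EllipticCurves.Rank1Residual
  Literature.NumberTheory.EllipticCurves.Rank1Residual.Typed
  Literature.NumberTheory.EllipticCurves.Rank1Residual.X11RankOneCertificates
  Literature.NumberTheory.EllipticCurves.AdachiNomotoShii2026
  Literature.NumberTheory.EllipticCurves.ModularForms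
  Literature.NumberTheory.EllipticCurves.CoatesLiTianZhai2015
  Summit.BirchSwinnertonDyer.Rank1Residual
  Summit.BirchSwinnertonDyer.Rank1Residual.X11b
  Summit.BirchSwinnertonDyer.Rank1Residual.X5.O1
  Summit.BirchSwinnertonDyer.Rank1Residual.AdditivePotMult
  Summit.BirchSwinnertonDyer.Rank1Residual.Additive
  Summit.BirchSwinnertonDyer.Rank1Residual.P2
  Summit.BirchSwinnertonDyer.BirchSwinnertonDyer.Rank1Residual.IntModel

namespace Summit.BirchSwinnertonDyer.BirchSwinnertonDyer.Theorems.AddPotGoodPrint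

/-! ## §4 Two global minimal models differ by `u = ±1`; hence `|u| = 1/2` from the raw twist to any global minimal model -/

/-- **Two global minimal models of one curve differ by `u = ±1`** (Silverman VII.1 Prop. 1.3(b) at every finite place —
the tree's `valuation_eq_one_of_isMinimal_smul_adicCompletion` — then `u, u⁻¹ ∈ ℤ`). A TOOL (the general form of the
step inside the tree's `u_eq_one_or_eq_neg_one_of_smul_quadraticTwist_of_squarefree`). [cite: SilvermanAEC2009, VII.1 Prop. 1.3(b) and VIII.8] -/
theorem u_eq_one_or_neg_one_of_isGloballyMinimal_smul {V W : WeierstrassCurve ℚ} [V.IsElliptic]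
    [V.IsGloballyMinimal] [W.IsGloballyMinimal] (C : VariableChange ℚ) (hC : C • V = W) :
    (C.u : ℚ) = 1 ∨ (C.u : ℚ) = -1 := by
  have hall : ∀ v : HeightOneSpectrum (𝓞 ℚ), v.valuation ℚ (C.u : ℚ) = 1 := by
    intro v
    have hΔV : V.Δ ≠ 0 := by rw [← V.coe_Δ']; exact V.Δ'.ne_zero
    have hΔ : (V.baseChange (v.adicCompletion ℚ)).Δ ≠ 0 := by
      rw [WeierstrassCurve.baseChange, WeierstrassCurve.map_Δ]
      exact (map_ne_zero _).mpr hΔV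
    haveI : (V.baseChange (v.adicCompletion ℚ)).IsMinimal (v.adicCompletionIntegers ℚ) :=
      IsGloballyMinimal.isMinimal v
    have hbc : (C.map (algebraMap ℚ (v.adicCompletion ℚ))) • V.baseChange (v.adicCompletion ℚ) =
        W.baseChange (v.adicCompletion ℚ) := by
      rw [WeierstrassCurve.baseChange, WeierstrassCurve.baseChange, WeierstrassCurve.map_variableChange, hC]
    haveI : ((C.map (algebraMap ℚ (v.adicCompletion ℚ))) • V.baseChange (v.adicCompletion ℚ)).IsMinimal
        (v.adicCompletionIntegers ℚ) := by
      rw [hbc]; exact IsGloballyMinimal.isMinimal v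
    exact valuation_eq_one_of_isMinimal_smul_adicCompletion v (V.baseChange (v.adicCompletion ℚ)) hΔ
      (C.map (algebraMap ℚ (v.adicCompletion ℚ))) (u := (C.u : ℚ)) rfl
  have hu : (C.u : ℚ) ∈ (algebraMap (𝓞 ℚ) ℚ).range :=
    HeightOneSpectrum.mem_integers_of_valuation_le_one ℚ (C.u : ℚ) (fun v => (hall v).le)
  have hui : (C.u : ℚ)⁻¹ ∈ (algebraMap (𝓞 ℚ) ℚ).range :=
    HeightOneSpectrum.mem_integers_of_valuation_le_one ℚ (C.u : ℚ)⁻¹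
      (fun v => by rw [map_inv₀, hall v, inv_one])
  obtain ⟨y, hy⟩ := hu
  obtain ⟨yi, hyi⟩ := hui
  obtain ⟨U, hU⟩ : ∃ n : ℤ, (n : ℚ) = C.u :=
    ⟨Rat.ringOfIntegersEquiv y, (Rat.ringOfIntegersEquiv_apply_coe y).trans hy⟩
  obtain ⟨Ui, hUi⟩ : ∃ n : ℤ, (n : ℚ) = (C.u : ℚ)⁻¹ :=
    ⟨Rat.ringOfIntegersEquiv yi, (Rat.ringOfIntegersEquiv_apply_coe yi).trans hyi⟩
  have hUU : Ui * U = 1 := by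
    exact_mod_cast (show (Ui : ℚ) * U = 1 by rw [hU, hUi, inv_mul_cancel₀ (Units.ne_zero C.u)])
  rcases Int.eq_one_or_neg_one_of_mul_eq_one' hUU with ⟨-, h⟩ | ⟨-, h⟩
  · left; rw [← hU, h]; simp
  · right; rw [← hU, h]; simp

/-- **Pal's `ũ` at `D ≡ 3 (mod 4)` for `37a1`**: for EVERY global minimal model `W = C • 37a1^{(D)}` of the twist
(`D ≡ 3 (mod 4)` square-free), `|u(C)| = 1/2` — `W` and `V_D = C₀ • 37a1^{(D)}` (`u(C₀) = 1/2`) are global minimal models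
of one curve. [cite: Pal2012, Prop. 2.5 and Cor. 2.6 (the prime 2)] [cite: SilvermanAEC2009, VII.1 Prop. 1.3(b)] -/
theorem abs_u_eq_half_of_twist37 (D : ℤ) (hD4 : D % 4 = 3) (hsq : ∀ q : ℕ, q.Prime → ¬ q ^ 2 ∣ D.natAbs)
    (W : WeierstrassCurve ℚ) [W.IsGloballyMinimal] (C : VariableChange ℚ)
    (hC : C • (⟨0, 0, 1, -1, 0⟩ : WeierstrassCurve ℚ).quadraticTwist (D : ℚ) = W) :
    |(C.u : ℚ)| = 1 / 2 := by
  have hD0 : (D : ℚ) ≠ 0 := by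
    have : D ≠ 0 := by rintro rfl; simp at hD4
    exact_mod_cast this
  haveI := isElliptic_twist37 hD0
  haveI := isGloballyMinimal_twist37 D hD4 hsq
  set C₀ : VariableChange ℚ := ⟨Units.mk0 (1 / 2 : ℚ) (by norm_num), 0, 0, 0⟩ with hC₀
  have hV : C₀ • (⟨0, 0, 1, -1, 0⟩ : WeierstrassCurve ℚ).quadraticTwist (D : ℚ) =
      ⟨0, 0, 0, -16 * (D : ℚ) ^ 2, 16 * (D : ℚ) ^ 3⟩ := half_smul_twist_37a1_eq (D : ℚ)
  have hW : (C * C₀⁻¹) • (⟨0, 0, 0, -16 * (D : ℚ) ^ 2, 16 * (D : ℚ) ^ 3⟩ : WeierstrassCurve ℚ) = W := by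
    rw [← hV, mul_smul, inv_smul_smul, hC]
  have hu := u_eq_one_or_neg_one_of_isGloballyMinimal_smul (C * C₀⁻¹) hW
  have hmul : ((C * C₀⁻¹).u : ℚ) = (C.u : ℚ) * 2 := by
    simp [VariableChange.mul_def, VariableChange.inv_def, hC₀]
  rw [hmul] at hu
  rcases hu with h | h
  · rw [show (C.u : ℚ) = 1 / 2 by linarith]; norm_num
  · rw [show (C.u : ℚ) = -(1 / 2) by linarith]; norm_num

/-! ## §6 The admissible twisting sets and the PRINT conclusion: C3″ on the family -/

/-- A product of numbers `≡ 1 (mod 4)` is `≡ 1 (mod 4)`. [folklore] -/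
theorem prod_mod_four_eq_one {Q : Finset ℕ} (hS : ∀ q ∈ Q, q % 4 = 1) : (∏ q ∈ Q, q) % 4 = 1 := by
  rw [Finset.prod_nat_mod, Finset.prod_congr rfl (fun q hq => hS q hq), Finset.prod_const_one]
  norm_num

/-- **Pal's period relation for the family**: for `D < 0`, `D ≡ 3 (mod 4)` square-free and EVERY global minimal model
`W` of `37a1^{(D)}`: `Ω(W)·√(−D) = |Ω⁻(37a1)|` — Pal 2012 Thm. 3.2 (`d < 0`; tree `realPeriodRat_mul_sqrt_of_twist_of_neg`)
with `ũ = |u(C)| = 1/2` (`abs_u_eq_half_of_twist37`) and `c_∞(W) = 2` (`Δ(W) = u⁻¹²D⁶·37 > 0`).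
[cite: Pal2012, Thm. 3.2 (case d < 0) with Prop. 2.5] -/
theorem realPeriodRat_twist37 [(⟨0, 0, 1, -1, 0⟩ : WeierstrassCurve ℚ).IsElliptic] (D : ℤ) (hD4 : D % 4 = 3)
    (hsq : ∀ q : ℕ, q.Prime → ¬ q ^ 2 ∣ D.natAbs)
    (hD : D < 0) (W : WeierstrassCurve ℚ) [W.IsGloballyMinimal] (C : VariableChange ℚ)
    (hC : C • (⟨0, 0, 1, -1, 0⟩ : WeierstrassCurve ℚ).quadraticTwist (D : ℚ) = W) :
    W.realPeriodRat * Real.sqrt (-(D : ℝ)) = (⟨0, 0, 1, -1, 0⟩ : WeierstrassCurve ℚ).imaginaryPeriodRat := by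
  have hDq : ((D : ℚ)) < 0 := by exact_mod_cast hD
  have hΔ37 : (⟨0, 0, 1, -1, 0⟩ : WeierstrassCurve ℚ).Δ = 37 := by
    simp only [WeierstrassCurve.Δ, WeierstrassCurve.b₂, WeierstrassCurve.b₄, WeierstrassCurve.b₆, WeierstrassCurve.b₈]
    norm_num
  have h := (⟨0, 0, 1, -1, 0⟩ : WeierstrassCurve ℚ).realPeriodRat_mul_sqrt_of_twist_of_neg hDq W C hC
  have hu : |((C.u : ℚ) : ℝ)| = 1 / 2 := by
    rw [← Rat.cast_abs, abs_u_eq_half_of_twist37 D hD4 hsq W C hC]; push_cast; ring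
  have hΔW : 0 < W.Δ := by
    rw [← hC, variableChange_Δ, quadraticTwist_Δ, hΔ37]
    have hu12 : (0 : ℚ) < ↑C.u⁻¹ ^ 12 := by
      rw [show (12 : ℕ) = 2 * 6 by rfl, pow_mul]
      exact pow_pos (lt_of_le_of_ne (sq_nonneg _) (Ne.symm (pow_ne_zero _ (Units.ne_zero _)))) 6
    have hd6 : (0 : ℚ) < (D : ℚ) ^ 6 := by
      rw [show (6 : ℕ) = 2 * 3 by rfl, pow_mul]
      exact pow_pos (lt_of_le_of_ne (sq_nonneg _) (Ne.symm (pow_ne_zero _ hDq.ne))) 3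
    positivity
  have hc : (W.baseChange ℝ).numRealComponents = 2 := by
    rw [numRealComponents_baseChange_real, if_pos hΔW]
  rw [hu, hc, Rat.cast_intCast] at h
  rw [h]; push_cast; ring

/-- **C3″ `AdditivePotGoodLowerHalfAtTwo` BY PRINT on the Adachi–Nomoto–Shii `37a1`-family** — the LOWER half
`MissingLowerBoundAt W 2` (`ord₂ #Ш_an(W) ≤ ord₂ #Ш(W)`) together with ALL the binders of C3″ at `W` decided in the kernel
(`r_an(W) = 0`, additive at `2`, `0 ≤ ord₂ j`, non-CM; moreover `E[2]` IRREDUCIBLE — the complement of the `56b1` family),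
for EVERY global minimal model `W` of `37a1^{(−m)}`, `m = ∏ Q`, `Q` any nonempty finite set of primes `q ≡ 1 (mod 4)`,
`q ≠ 37`, with `a_q(37a1)` odd (printed: "41, 53, 73, 101, 149, 157, …; in fact there are infinitely many such primes",
ANS §1 Example). INPUTS, all by name / displayed: (i) PRINT — Adachi–Nomoto–Shii 2026 Thm. 4.3 (ii) with its equality
clause (`thm43_rectangular_n1`), applied with the paper's own example data for `f₂ = 37a1` (§5.2: "the period lattice of
`f₂` is rectangular, `v₂(L(f₂, χ₄, 1)/Ω⁻_{f₂}) = 0`" — the binders `W4`, `x₄`, `hv₄ : val₂ x₄ = 1`; optimal datum `Dt` with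
Manin constant `1`; `x₁` with `L(37a1,1) = x₁Ω⁺`, e.g. `x₁ = 0`; `N(37a1) = 37`), modularity `hmod`, GZK `hGZK` (rank `0` ⇒
`Reg = 1`); (ii) KERNEL — `V_{−m}` global minimal and additive at `2` (§3, §5), Pal's `Ω(W)√m = |Ω⁻(37a1)|` with `ũ = 1/2`,
`c_∞ = 2` (`realPeriodRat_twist37`), odd torsion (`E[2]` irreducible, Mazur), whence the printed equality
`v₂(L(f₂,χ_{4m},1)/Ω⁻) = 0` (tree currency `val₂ x = 1`, `L(W,1) = x·Ω⁻/(2√m)`) gives `L(W,1)/Ω(W) = x/2`, a `2`-adic UNIT,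
and `#Ш_an(W) = x·#tors²/(2·Tam)` has `ord₂ = −ord₂ Tam(W) ≤ 0 ≤ ord₂ #Ш(W)`. No reading, no instrument; the record-tier
content is exactly the displayed base data of ONE curve (`37a1`), all printed in the source. Closes nothing at the
`∀`-level; BSD is not proved by any of this. [cite: AdachiNomotoShii2026, Thm. 4.3 (ii) (arXiv:2403.11474 p. 11 L103–L157), §1 Example (pp. 2–3), §5.2 (p. 15 L16–L20)]
[cite: Pal2012, Thm. 3.2] [cite: Miller2011LMS, Def. 1.1] -/
theorem printFamily37a1_lower (h43 : thm43_rectangular_n1) (hmod : hasEntireLFunction_rat)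
    (hGZK : rank_eq_analyticRank_of_analyticRank_le_one)
    [(⟨0, 0, 1, -1, 0⟩ : WeierstrassCurve ℚ).IsElliptic] [(⟨0, 0, 1, -1, 0⟩ : WeierstrassCurve ℚ).IsGloballyMinimal] :
    ∀ (hN : (⟨0, 0, 1, -1, 0⟩ : WeierstrassCurve ℚ).conductorNorm ℤ = 37)
      [NeZero ((⟨0, 0, 1, -1, 0⟩ : WeierstrassCurve ℚ).conductorNorm ℤ)]
      (Dt : ModularParametrizationData (⟨0, 0, 1, -1, 0⟩ : WeierstrassCurve ℚ)
        ((⟨0, 0, 1, -1, 0⟩ : WeierstrassCurve ℚ).conductorNorm ℤ)),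
      Zhai2021.IsOptimalDatum (⟨0, 0, 1, -1, 0⟩ : WeierstrassCurve ℚ) Dt → Dt.c.natAbs = 1 →
    ∀ (x₁ : ℚ), (⟨0, 0, 1, -1, 0⟩ : WeierstrassCurve ℚ).entireLFunction 1 =
        (x₁ : ℂ) * (leastRealPeriod (⟨0, 0, 1, -1, 0⟩ : WeierstrassCurve ℚ) : ℂ) →
    ∀ (W4 : WeierstrassCurve ℚ) [W4.IsElliptic] [W4.IsGloballyMinimal],
      (∃ C : VariableChange ℚ, C • (⟨0, 0, 1, -1, 0⟩ : WeierstrassCurve ℚ).quadraticTwist (-1 : ℚ) = W4) →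
    ∀ (x₄ : ℚ), IsAlgPart (⟨0, 0, 1, -1, 0⟩ : WeierstrassCurve ℚ) W4 (-1) x₄ → val₂ x₄ = 1 →
    ∀ (Q : Finset ℕ), Q.Nonempty →
      (∀ q ∈ Q, q.Prime ∧ q % 4 = 1 ∧ q ≠ 37 ∧
        ¬ (2 : ℤ) ∣ aq (⟨0, 0, 1, -1, 0⟩ : WeierstrassCurve ℚ) q) →
    ∀ (W : WeierstrassCurve ℚ) [W.IsElliptic] [W.IsGloballyMinimal],
      (∃ C : VariableChange ℚ,
        C • (⟨0, 0, 1, -1, 0⟩ : WeierstrassCurve ℚ).quadraticTwist (-((∏ q ∈ Q, q : ℕ) : ℚ)) = W) →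
      W.analyticRank = 0 ∧ Addv W 2 ∧ 0 ≤ padicValRat 2 W.j ∧ ¬ W.HasCM ∧ Irr W 2 ∧
        MissingLowerBoundAt W 2 := by
  intro hN _ Dt hopt hc1 x₁ hx₁ W4 _ _ hW4 x₄ hx₄ hv₄ Q hQ hS W _ _ hW
  haveI : Fact (Nat.Prime 2) := ⟨Nat.prime_two⟩
  -- the twisting parameter
  have hS1 : ∀ q ∈ Q, q.Prime := fun q hq => (hS q hq).1
  have hm0 : (∏ q ∈ Q, q) ≠ 0 := prod_ne_zero_of_primes hS1
  have hm4 : (∏ q ∈ Q, q) % 4 = 1 := prod_mod_four_eq_one fun q hq => (hS q hq).2.1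
  have hD4 : (-((∏ q ∈ Q, q : ℕ) : ℤ)) % 4 = 3 := by omega
  have hDlt : (-((∏ q ∈ Q, q : ℕ) : ℤ)) < 0 := by omega
  have hnat : (-((∏ q ∈ Q, q : ℕ) : ℤ)).natAbs = ∏ q ∈ Q, q := by
    rw [Int.natAbs_neg, Int.natAbs_natCast]
  have hsqD : ∀ q : ℕ, q.Prime → ¬ q ^ 2 ∣ (-((∏ q ∈ Q, q : ℕ) : ℤ)).natAbs := by
    rw [hnat]; exact not_sq_dvd_prod_of_primes hS1
  have hpf : (∏ q ∈ Q, q).primeFactors = Q := Nat.primeFactors_prod hS1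
  have hcast : (((-((∏ q ∈ Q, q : ℕ) : ℤ)) : ℤ) : ℚ) = -((∏ q ∈ Q, q : ℕ) : ℚ) := by push_cast; ring
  have hW' : ∃ C : VariableChange ℚ,
      C • (⟨0, 0, 1, -1, 0⟩ : WeierstrassCurve ℚ).quadraticTwist (((-((∏ q ∈ Q, q : ℕ) : ℤ)) : ℤ) : ℚ) = W := by
    rw [hcast]; exact hW
  -- the setting of Thm 4.3
  have hTS : TwistSetting ((⟨0, 0, 1, -1, 0⟩ : WeierstrassCurve ℚ).conductorNorm ℤ) (∏ q ∈ Q, q)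
      (-((∏ q ∈ Q, q : ℕ) : ℤ)) 1 := by
    refine ⟨Literature.NumberTheory.Sieve.LcmEuler.squarefree_prod_of_primes hS1, not_two_dvd_prod_of_mod_four fun q hq => ⟨(hS q hq).1, (hS q hq).2.1⟩,
      by rw [hpf]; exact hQ, hnat, by rw [nOf, if_neg (by omega)], ?_, fun _ => by rw [hN]; decide⟩
    rw [hN]
    refine ((Nat.Prime.coprime_iff_not_dvd (by norm_num : Nat.Prime 37)).mpr fun h37 => ?_).symm
    exact (hS 37 (mem_of_prime_dvd_prod hS1 (by norm_num) h37)).2.2.1 rfl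
  have hodd : ∀ q ∈ Q, ¬ (2 : ℤ) ∣ aq (⟨0, 0, 1, -1, 0⟩ : WeierstrassCurve ℚ) q - 2 := fun q hq h =>
    (hS q hq).2.2.2 (by have := dvd_add h (dvd_refl (2 : ℤ)); simpa using this)
  have hVm : IsVm (⟨0, 0, 1, -1, 0⟩ : WeierstrassCurve ℚ) (∏ q ∈ Q, q) 0 := by
    refine ⟨fun q hq => ⟨fun h => ?_, Nat.zero_le _⟩, ?_⟩
    · rw [hpf] at hq; exact hodd q hq (by rw [h]; simp)
    · obtain ⟨q₀, hq₀⟩ := hQ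
      exact ⟨q₀, by rw [hpf]; exact hq₀, padicValInt.eq_zero_of_not_dvd (hodd q₀ hq₀)⟩
  have hInS : ∀ q ∈ (∏ q ∈ Q, q).primeFactors, InSPlus (⟨0, 0, 1, -1, 0⟩ : WeierstrassCurve ℚ) 0 q := by
    intro q hq
    rw [hpf] at hq
    obtain ⟨hqP, hq4, hq37, -⟩ := hS q hq
    refine ⟨⟨hqP, by omega, ?_, fun h => hodd q hq (by rw [h]; simp),
      padicValInt.eq_zero_of_not_dvd (hodd q hq)⟩, hq4⟩
    rw [hN]; intro h; exact hq37 ((Nat.prime_dvd_prime_iff_eq hqP (by norm_num)).mp h)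
  -- Thm 4.3 (ii), equality case
  have hrect : IsRectangular (⟨0, 0, 1, -1, 0⟩ : WeierstrassCurve ℚ) := by
    rw [IsRectangular]
    simp only [WeierstrassCurve.Δ, WeierstrassCurve.b₂, WeierstrassCurve.b₄, WeierstrassCurve.b₆, WeierstrassCurve.b₈]
    norm_num
  obtain ⟨-, h2⟩ := h43 _ Dt hopt hc1 hrect x₁ hx₁ W4 hW4 x₄ hx₄
    (∏ q ∈ Q, q) (-((∏ q ∈ Q, q : ℕ) : ℤ)) 0 hTS hVm W hW'
  obtain ⟨x, hxalg, -, heq⟩ := h2 (fun q hq => ⟨0, by norm_num, hInS q hq⟩)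
  have hvx : val₂ x = 1 := by
    rw [heq ⟨hv₄, hInS⟩, hv₄]
    simp [wr, δ₀, δ₂]
  have hx0 : x ≠ 0 := ne_zero_of_val₂_ne_top (by rw [hvx]; exact WithTop.coe_ne_top)
  have hvx' : padicValRat 2 x = 1 := by
    have := hvx; rw [val₂_of_ne_zero hx0] at this; exact_mod_cast this
  -- the algebraic part in the BSD currency: `L(W,1) = x · Ω⁻(37a1) / (2√m)`
  have hΩm : 0 < (⟨0, 0, 1, -1, 0⟩ : WeierstrassCurve ℚ).imaginaryPeriodRat := imaginaryPeriodRat_pos _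
  have hmpos : (0 : ℝ) < ((∏ q ∈ Q, q : ℕ) : ℝ) := by exact_mod_cast Nat.pos_of_ne_zero hm0
  have hsqrt0 : Real.sqrt ((∏ q ∈ Q, q : ℕ) : ℝ) ≠ 0 := (Real.sqrt_pos.mpr hmpos).ne'
  have hper : periodSgn (⟨0, 0, 1, -1, 0⟩ : WeierstrassCurve ℚ) (-((∏ q ∈ Q, q : ℕ) : ℤ)) =
      (⟨0, 0, 1, -1, 0⟩ : WeierstrassCurve ℚ).imaginaryPeriodRat := by
    simp only [periodSgn, if_neg (not_lt.mpr hDlt.le)]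
  have hM : twistCharConductor (-((∏ q ∈ Q, q : ℕ) : ℤ)) = 4 * ∏ q ∈ Q, q := by
    rw [twistCharConductor_of_mod_four_ne_one (by omega), hnat]
  have hsqrt4 : Real.sqrt ((4 * ∏ q ∈ Q, q : ℕ) : ℝ) = 2 * Real.sqrt ((∏ q ∈ Q, q : ℕ) : ℝ) := by
    push_cast
    rw [Real.sqrt_mul (by norm_num), show Real.sqrt (4 : ℝ) = 2 by
      rw [show (4 : ℝ) = 2 ^ 2 by norm_num, Real.sqrt_sq (by norm_num)]]
  have hL : W.entireLFunction 1 = (x : ℂ) * ((⟨0, 0, 1, -1, 0⟩ : WeierstrassCurve ℚ).imaginaryPeriodRat : ℂ) /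
      (2 * (Real.sqrt ((∏ q ∈ Q, q : ℕ) : ℝ) : ℂ)) := by
    rw [hxalg, hper, hM, hsqrt4]; push_cast; ring
  have hLne : W.entireLFunction 1 ≠ 0 := by
    rw [hL]
    refine div_ne_zero (mul_ne_zero (by exact_mod_cast hx0) (by exact_mod_cast hΩm.ne'))
      (mul_ne_zero two_ne_zero (by exact_mod_cast hsqrt0))
  have hr : W.analyticRank = 0 := (W.analyticRank_eq_zero_iff_holds (hmod W)).mpr hLne
  -- the habitat and the period, on `W = C • 37a1^{(D)}`
  obtain ⟨C, hC⟩ := hW'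
  have hΩ := realPeriodRat_twist37 _ hD4 hsqD hDlt W C hC
  have hnegD : (-(((-((∏ q ∈ Q, q : ℕ) : ℤ)) : ℤ) : ℝ)) = ((∏ q ∈ Q, q : ℕ) : ℝ) := by push_cast; ring
  rw [hnegD] at hΩ
  have hΩ' : W.realPeriodRat = (⟨0, 0, 1, -1, 0⟩ : WeierstrassCurve ℚ).imaginaryPeriodRat /
      Real.sqrt ((∏ q ∈ Q, q : ℕ) : ℝ) := by
    rw [← hΩ, mul_div_cancel_right₀ _ hsqrt0]
  subst hC
  have hab := habitat_smul_twist37 _ hD4 hsqD C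
  -- rank 0, regulator 1, odd torsion
  have hrank : (C • (⟨0, 0, 1, -1, 0⟩ : WeierstrassCurve ℚ).quadraticTwist
      (((-((∏ q ∈ Q, q : ℕ) : ℤ)) : ℤ) : ℚ)).mordellWeilRank = 0 := by
    have := (hGZK _ (show (C • (⟨0, 0, 1, -1, 0⟩ : WeierstrassCurve ℚ).quadraticTwist
      (((-((∏ q ∈ Q, q : ℕ) : ℤ)) : ℤ) : ℚ)).analyticRank ≤ 1 by omega)).1
    omega
  have hreg := (C • (⟨0, 0, 1, -1, 0⟩ : WeierstrassCurve ℚ).quadraticTwist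
      (((-((∏ q ∈ Q, q : ℕ) : ℤ)) : ℤ) : ℚ)).regulator_eq_one_of_rank_zero hrank
  have htors := padicValNat_torsionOrder_eq_zero_of_irreducible _ 2 hab.2.2.2
  have ht0 := (C • (⟨0, 0, 1, -1, 0⟩ : WeierstrassCurve ℚ).quadraticTwist
      (((-((∏ q ∈ Q, q : ℕ) : ℤ)) : ℤ) : ℚ)).torsionOrder_pos_holds
  have hc0 : 0 < (C • (⟨0, 0, 1, -1, 0⟩ : WeierstrassCurve ℚ).quadraticTwist
      (((-((∏ q ∈ Q, q : ℕ) : ℤ)) : ℤ) : ℚ)).tamagawaProduct := tamagawaProduct_pos_holds _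
  refine ⟨hr, hab.1, hab.2.1, hab.2.2.1, hab.2.2.2, x * ((C • (⟨0, 0, 1, -1, 0⟩ : WeierstrassCurve ℚ).quadraticTwist
      (((-((∏ q ∈ Q, q : ℕ) : ℤ)) : ℤ) : ℚ)).torsionOrder : ℚ) ^ 2 /
      (2 * ((C • (⟨0, 0, 1, -1, 0⟩ : WeierstrassCurve ℚ).quadraticTwist
      (((-((∏ q ∈ Q, q : ℕ) : ℤ)) : ℤ) : ℚ)).tamagawaProduct : ℚ)), ?_, ?_⟩
  · -- `#Ш_an(W) = x · #tors² / (2 · Tam)`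
    have hΩC : ((⟨0, 0, 1, -1, 0⟩ : WeierstrassCurve ℚ).imaginaryPeriodRat : ℂ) ≠ 0 := by
      exact_mod_cast hΩm.ne'
    have hsC : ((Real.sqrt ((∏ q ∈ Q, q : ℕ) : ℝ) : ℝ) : ℂ) ≠ 0 := by exact_mod_cast hsqrt0
    have hcC : (((C • (⟨0, 0, 1, -1, 0⟩ : WeierstrassCurve ℚ).quadraticTwist
      (((-((∏ q ∈ Q, q : ℕ) : ℤ)) : ℤ) : ℚ)).tamagawaProduct : ℕ) : ℂ) ≠ 0 := by exact_mod_cast hc0.ne'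
    have hsC' : ((Real.sqrt (∏ i ∈ Q, (i : ℝ)) : ℝ) : ℂ) ≠ 0 := by rw [← Nat.cast_prod]; exact hsC
    rw [shaAn_def, leadingLCoeff_eq_of_analyticRank_eq_zero _ hr, hL, hreg, hΩ']
    push_cast
    field_simp
  · -- `ord₂(x · #tors² / (2 · Tam)) = −ord₂ Tam ≤ 0 ≤ ord₂ #Ш`
    have ht0' : ((C • (⟨0, 0, 1, -1, 0⟩ : WeierstrassCurve ℚ).quadraticTwist
      (((-((∏ q ∈ Q, q : ℕ) : ℤ)) : ℤ) : ℚ)).torsionOrder : ℚ) ≠ 0 := by exact_mod_cast ht0.ne'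
    have hc0' : ((C • (⟨0, 0, 1, -1, 0⟩ : WeierstrassCurve ℚ).quadraticTwist
      (((-((∏ q ∈ Q, q : ℕ) : ℤ)) : ℤ) : ℚ)).tamagawaProduct : ℚ) ≠ 0 := by exact_mod_cast hc0.ne'
    have h2 : padicValRat 2 (2 : ℚ) = 1 := by exact_mod_cast padicValRat.self (p := 2) one_lt_two
    rw [padicValRat.div (mul_ne_zero hx0 (pow_ne_zero 2 ht0')) (mul_ne_zero two_ne_zero hc0'),
      padicValRat.mul hx0 (pow_ne_zero 2 ht0'), padicValRat.pow, padicValRat.mul two_ne_zero hc0',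
      padicValRat.of_nat, padicValRat.of_nat, htors, hvx', h2]
    simp only [Nat.cast_zero, mul_zero, add_zero]
    have : (0 : ℤ) ≤ (padicValNat 2 (C • (⟨0, 0, 1, -1, 0⟩ : WeierstrassCurve ℚ).quadraticTwist
      (((-((∏ q ∈ Q, q : ℕ) : ℤ)) : ℤ) : ℚ)).shaOrder : ℤ) := Int.natCast_nonneg _
    have : (0 : ℤ) ≤ (padicValNat 2 (C • (⟨0, 0, 1, -1, 0⟩ : WeierstrassCurve ℚ).quadraticTwist
      (((-((∏ q ∈ Q, q : ℕ) : ℤ)) : ℤ) : ℚ)).tamagawaProduct : ℤ) := Int.natCast_nonneg _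
    linarith

end Summit.BirchSwinnertonDyer.BirchSwinnertonDyer.Theorems.AddPotGoodPrint

end
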